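import Summits.ValiantsHypothesis.ValiantsHypothesis.Theorems.SymPencilPerFourCrossKronecker
import Summits.ValiantsHypothesis.ValiantsHypothesis.Theorems.SymPencilPerFourSixDimCross

/-!
# Route `SymPencil` — LEAF 4 (`stub_crossFilter`) of the SING-SIX classification: a
# six-dimensional subspace of a cross with a per-direction family of `≤ 6` squares is an
# arm-coordinate hyperplane of the cross (`--supports` stmt-ValiantsHypothesis-5674
# `SdcSuperquadratic`; V-side LIST of cell `(10,6,6)`; rung currency only, nothing here bears on
# `VP ≠ VNP`)

**Theorem** (`stub_crossFilter`, the statement of leaf 4 of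
`Cruxes/SdcSuperquadratic/Lines/sing_six_classification.lean` with `InCross`, `PerDirSix`,
`VCrossType` unfolded).  Over a field of characteristic `0`, let `W` be a `6`-dimensional linear
subspace of a cross `X_{lc}` (support in row `l ∪` column `c`) such that for every `y ∈ W` the
`s²`-coefficient of `per_4 (u + s y)` is a combination of `≤ 6` (here: `< 9`) squares of linear
functionals of `u`.  Then `W = X_{lc} ∩ {x_e = 0}` for an arm cell `e ∈ X_{lc} ∖ {(l,c)}` — the
`V×`-type of the V-side LIST (killed by the pencil in `SymPencilPerFourCrossSixTransport`).

Proof.  `SymPencilPerFourCrossKronecker.prod_arms_eq_zero_on`: the product of the six arm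
coordinates vanishes on `W`; a product of linear functionals vanishing on a subspace has a factor
vanishing on it (`SymPencilPerFourPairingHyperplane.exists_forall_eq_zero_of_prod_eq_zero`); so
`W` lies in the span of the six remaining cross cells, which has dimension `≤ 6 = dim W`
(`crossFilter33`); a general cross is moved to `(3,3)` by the row/column swaps
(`SymPencilPerFourLowRankSeven.sqFamilySwap_map`, `crossFilter`).

Honest framing: one leaf of the LIST (leaves 1, 3, 5 and the ten residue stubs of leaf 2 remain);
`27 ≤ sdc(per₄) ≤ 29` unchanged, stmt-5674 open, `VP ≠ VNP` not moved, no summit statement is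
proved here.  No definitions, no named facts. [folklore]
-/

noncomputable section

-- single-conjunct layout: Sub = Summit, duplicated namespace component intended
set_option linter.dupNamespace false

namespace Summit.ValiantsHypothesis.ValiantsHypothesis.Theorems.SymPencilPerFourCrossFilter

open Matrix MvPolynomial Finset Module
open Literature.Computability.AlgebraicComplexity
open Summit.ValiantsHypothesis.ValiantsHypothesis.Theorems.SymPencilPerFourBlocks
open Summit.ValiantsHypothesis.ValiantsHypothesis.Theorems.SymPencilPerFourCrossKronecker
open Summit.ValiantsHypothesis.ValiantsHypothesis.Theorems.SymPencilPerFourSixDimCross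
open Summit.ValiantsHypothesis.ValiantsHypothesis.Theorems.SymPencilPerFourPairingHyperplane
open Summit.ValiantsHypothesis.ValiantsHypothesis.Theorems.SymPencilPerFourLowRankSeven

variable {K : Type*} [Field K]

/-- **Vectors supported on the cross `X₃₃` minus one cross cell `e` span a space of dimension
`≤ 6`**, as a submodule `C` with: every such vector lies in `C`. [folklore] -/
theorem exists_crossSpan_erase (e : Fin 4 × Fin 4) (he : e.1 = 3 ∨ e.2 = 3) :
    ∃ C : Submodule K (Fin 4 × Fin 4 → K), finrank K C ≤ 6 ∧
      ∀ z : Fin 4 × Fin 4 → K, (∀ i j : Fin 4, i ≠ 3 → j ≠ 3 → z (i, j) = 0) → z e = 0 → z ∈ C := by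
  classical
  set T : Finset (Fin 4 × Fin 4) :=
    (Finset.univ.filter fun p : Fin 4 × Fin 4 => p.1 = 3 ∨ p.2 = 3).erase e with hTdef
  have memT : ∀ p, p ∈ T ↔ (p.1 = 3 ∨ p.2 = 3) ∧ p ≠ e := fun p => by
    rw [hTdef, Finset.mem_erase, Finset.mem_filter]
    simp only [Finset.mem_univ, true_and]
    tauto
  have heT : e ∈ Finset.univ.filter (fun p : Fin 4 × Fin 4 => p.1 = 3 ∨ p.2 = 3) :=
    Finset.mem_filter.2 ⟨Finset.mem_univ _, he⟩
  have hTcard : T.card = 6 := by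
    rw [hTdef, Finset.card_erase_of_mem heT, crossCells_card]
  refine ⟨Submodule.span K ↑(T.image fun p => (Pi.single p (1 : K) : Fin 4 × Fin 4 → K)),
    (finrank_span_finset_le_card _).trans (Finset.card_image_le.trans hTcard.le), ?_⟩
  intro z hz hze
  have hz0 : ∀ p, p ∉ T → z p = 0 := by
    intro p hp
    rw [memT] at hp
    by_cases hpe : p = e
    · rw [hpe]; exact hze
    · have hnc : ¬ (p.1 = 3 ∨ p.2 = 3) := fun hc => hp ⟨hc, hpe⟩
      push Not at hnc
      exact hz p.1 p.2 hnc.1 hnc.2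
  have hdecomp : z = ∑ p ∈ T, z p • (Pi.single p (1 : K) : Fin 4 × Fin 4 → K) :=
    calc z = ∑ p, (Pi.single p (z p) : Fin 4 × Fin 4 → K) := (Finset.univ_sum_single z).symm
      _ = ∑ p ∈ T, (Pi.single p (z p) : Fin 4 × Fin 4 → K) := by
        symm
        refine Finset.sum_subset (Finset.subset_univ T) fun p _ hp => ?_
        rw [hz0 p hp, Pi.single_zero]
      _ = ∑ p ∈ T, z p • (Pi.single p (1 : K) : Fin 4 × Fin 4 → K) :=
        Finset.sum_congr rfl fun p _ => by
          ext p'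
          by_cases hp : p' = p
          · subst hp; simp
          · simp [hp]
  rw [hdecomp]
  exact Submodule.sum_mem _ fun p hp => Submodule.smul_mem _ _
    (Submodule.subset_span (Finset.mem_coe.2 (Finset.mem_image_of_mem _ hp)))

/-- **Leaf 4 at the cross `X₃₃`.**  A `6`-dimensional `W ⊆ X₃₃` whose elements all have the
swapped property with `< 9` squares is `X₃₃ ∩ {x_e = 0}` for an arm cell `e ≠ (3,3)`. [folklore] -/
theorem crossFilter33 [CharZero K] {ι : Type*} [Fintype ι] (hι : Fintype.card ι < 9)
    (W : Submodule K (Fin 4 × Fin 4 → K))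
    (hX : ∀ x ∈ W, ∀ i j : Fin 4, i ≠ 3 → j ≠ 3 → x (i, j) = 0) (h6 : finrank K W = 6)
    (hW : ∀ y ∈ W, ∃ (c : ι → K) (Λ : ι → ((Fin 4 × Fin 4 → K) →ₗ[K] K)),
      ∀ u : Fin 4 × Fin 4 → K, ∃ e₀ e₁ : K, ∀ s : K,
        eval (u + s • y) (perPoly (Fin 4) K) = e₀ + s * e₁ + s ^ 2 * ∑ k, c k * (Λ k u) ^ 2) :
    ∃ e : Fin 4 × Fin 4, (e.1 = 3 ∨ e.2 = 3) ∧ e ≠ (3, 3) ∧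
      ∀ x : Fin 4 × Fin 4 → K, x ∈ W ↔
        ((∀ i j : Fin 4, i ≠ 3 → j ≠ 3 → x (i, j) = 0) ∧ x e = 0) := by
  classical
  -- the product of the six arm coordinates, as a product of coordinate functionals
  let f : Fin 3 ⊕ Fin 3 → ((Fin 4 × Fin 4 → K) →ₗ[K] K) := fun t =>
    Sum.elim (fun k => LinearMap.proj ((3 : Fin 4), (Fin.castSucc k : Fin 4)))
      (fun k => LinearMap.proj ((Fin.castSucc k : Fin 4), (3 : Fin 4))) t
  have hprod : ∀ y ∈ W, ∏ t ∈ (Finset.univ : Finset (Fin 3 ⊕ Fin 3)), f t y = 0 := by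
    intro y hy
    have h := prod_arms_eq_zero_on hι W hX hW y hy
    rw [Fintype.prod_sum_type]
    simp only [f, Sum.elim_inl, Sum.elim_inr, LinearMap.coe_proj, Function.eval,
      Fin.prod_univ_three]
    have e0 : (Fin.castSucc (0 : Fin 3) : Fin 4) = 0 := rfl
    have e1 : (Fin.castSucc (1 : Fin 3) : Fin 4) = 1 := rfl
    have e2 : (Fin.castSucc (2 : Fin 3) : Fin 4) = 2 := rfl
    rw [e0, e1, e2]
    linear_combination h
  obtain ⟨t, -, ht⟩ := exists_forall_eq_zero_of_prod_eq_zero W f Finset.univ hprod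
  -- the vanishing arm coordinate `e`
  obtain ⟨e, heW, he, hne⟩ : ∃ e : Fin 4 × Fin 4, (∀ y ∈ W, y e = 0) ∧ (e.1 = 3 ∨ e.2 = 3) ∧
      e ≠ (3, 3) := by
    rcases t with k | k
    · refine ⟨((3 : Fin 4), (Fin.castSucc k : Fin 4)), fun y hy => ht y hy, Or.inl rfl, ?_⟩
      intro h
      exact (Fin.castSucc_lt_last k).ne (congr_arg Prod.snd h)
    · refine ⟨((Fin.castSucc k : Fin 4), (3 : Fin 4)), fun y hy => ht y hy, Or.inr rfl, ?_⟩
      intro h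
      exact (Fin.castSucc_lt_last k).ne (congr_arg Prod.fst h)
  obtain ⟨C, hCle, hCmem⟩ := exists_crossSpan_erase (K := K) e he
  have hWC : W ≤ C := fun y hy => hCmem y (hX y hy) (heW y hy)
  have hWeq : W = C := Submodule.eq_of_le_of_finrank_le hWC (hCle.trans h6.ge)
  refine ⟨e, he, hne, fun x => ⟨fun hx => ⟨hX x hx, heW x hx⟩, fun hx => ?_⟩⟩
  rw [hWeq]
  exact hCmem x hx.1 hx.2

/-- **Leaf 4 at a general cross `X_{lc}`** (transport by the swaps `3 ↔ l`, `3 ↔ c`). [folklore] -/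
theorem crossFilter [CharZero K] {ι : Type*} [Fintype ι] (hι : Fintype.card ι < 9)
    (W : Submodule K (Fin 4 × Fin 4 → K)) {l c : Fin 4}
    (hX : ∀ x ∈ W, ∀ i j : Fin 4, i ≠ l → j ≠ c → x (i, j) = 0) (h6 : finrank K W = 6)
    (hW : ∀ y ∈ W, ∃ (c : ι → K) (Λ : ι → ((Fin 4 × Fin 4 → K) →ₗ[K] K)),
      ∀ u : Fin 4 × Fin 4 → K, ∃ e₀ e₁ : K, ∀ s : K,
        eval (u + s • y) (perPoly (Fin 4) K) = e₀ + s * e₁ + s ^ 2 * ∑ k, c k * (Λ k u) ^ 2) :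
    ∃ e : Fin 4 × Fin 4, (e.1 = l ∨ e.2 = c) ∧ e ≠ (l, c) ∧
      ∀ x : Fin 4 × Fin 4 → K, x ∈ W ↔
        ((∀ i j : Fin 4, i ≠ l → j ≠ c → x (i, j) = 0) ∧ x e = 0) := by
  set σ : Equiv.Perm (Fin 4) := Equiv.swap 3 l with hσ
  set τ : Equiv.Perm (Fin 4) := Equiv.swap 3 c with hτ
  set Φ : (Fin 4 × Fin 4 → K) ≃ₗ[K] (Fin 4 × Fin 4 → K) :=
    LinearEquiv.funCongrLeft K K (Equiv.prodCongr σ τ) with hΦ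
  have hΦa : ∀ (x : Fin 4 × Fin 4 → K) (i j : Fin 4), Φ x (i, j) = x (σ i, τ j) := fun x i j => rfl
  have hσ3 : σ 3 = l := by rw [hσ, Equiv.swap_apply_left]
  have hτ3 : τ 3 = c := by rw [hτ, Equiv.swap_apply_left]
  have hW' := sqFamilySwap_map W Φ (fun z => eval_perPoly_comp_prodCongr σ τ z) hW
  set W' := W.map Φ.toLinearMap with hW'def
  have hfin : finrank K W' = 6 := by rw [hW'def, LinearEquiv.finrank_map_eq, h6]
  -- support transport: `x ∈ X_{lc}` iff `Φ x ∈ X₃₃`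
  have hsupp : ∀ x : Fin 4 × Fin 4 → K, (∀ i j : Fin 4, i ≠ l → j ≠ c → x (i, j) = 0) ↔
      (∀ i j : Fin 4, i ≠ 3 → j ≠ 3 → Φ x (i, j) = 0) := by
    intro x
    constructor
    · intro h i j hi hj
      rw [hΦa]
      refine h (σ i) (τ j) (fun h' => hi ?_) (fun h' => hj ?_)
      · exact σ.injective (h'.trans hσ3.symm)
      · exact τ.injective (h'.trans hτ3.symm)
    · intro h i j hi hj
      have h' := h (σ.symm i) (τ.symm j) (fun h'' => hi ?_) (fun h'' => hj ?_)
      · rwa [hΦa, Equiv.apply_symm_apply, Equiv.apply_symm_apply] at h'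
      · rw [← hσ3, ← h'', Equiv.apply_symm_apply]
      · rw [← hτ3, ← h'', Equiv.apply_symm_apply]
  have hX' : ∀ x ∈ W', ∀ i j : Fin 4, i ≠ 3 → j ≠ 3 → x (i, j) = 0 := by
    rintro _ ⟨x, hx, rfl⟩
    exact (hsupp x).1 (hX x hx)
  obtain ⟨e', he', hne', hmem'⟩ := crossFilter33 hι W' hX' hfin hW'
  have hmemW : ∀ x : Fin 4 × Fin 4 → K, x ∈ W ↔ Φ x ∈ W' := fun x => by
    rw [hW'def, Submodule.mem_map_equiv, LinearEquiv.symm_apply_apply]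
  refine ⟨(σ e'.1, τ e'.2), ?_, ?_, fun x => ?_⟩
  · rcases he' with h1 | h2
    · exact Or.inl (by rw [h1, hσ3])
    · exact Or.inr (by rw [h2, hτ3])
  · intro h
    simp only [Prod.mk.injEq] at h
    exact hne' (Prod.ext (σ.injective (h.1.trans hσ3.symm)) (τ.injective (h.2.trans hτ3.symm)))
  · rw [hmemW x, hmem' (Φ x), ← hsupp x, hΦa]

/-- **LEAF 4 — CROSS FILTER** of `Cruxes/SdcSuperquadratic/Lines/sing_six_classification.lean`,
verbatim with `InCross`, `PerDirSix`, `VCrossType` unfolded: a `6`-dimensional `W` inside a cross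
with a per-direction family of `≤ 6` squares is an arm-coordinate hyperplane `X_{lc} ∩ {x_e = 0}`.
[folklore] -/
theorem stub_crossFilter [CharZero K] :
    ∀ W : Submodule K (Fin 4 × Fin 4 → K), finrank K W = 6 →
      (∃ l c : Fin 4, ∀ x ∈ W, ∀ i j : Fin 4, i ≠ l → j ≠ c → x (i, j) = 0) →
      (∀ y ∈ W, ∃ (c : Fin 6 → K) (Λ : Fin 6 → ((Fin 4 × Fin 4 → K) →ₗ[K] K)),
        ∀ u : Fin 4 × Fin 4 → K, ∃ e₀ e₁ : K, ∀ s : K,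
          eval (u + s • y) (perPoly (Fin 4) K) = e₀ + s * e₁ + s ^ 2 * ∑ k, c k * (Λ k u) ^ 2) →
      ∃ (l c : Fin 4) (e : Fin 4 × Fin 4), (e.1 = l ∨ e.2 = c) ∧ e ≠ (l, c) ∧
        ∀ x : Fin 4 × Fin 4 → K, x ∈ W ↔
          ((∀ i j : Fin 4, i ≠ l → j ≠ c → x (i, j) = 0) ∧ x e = 0) := by
  intro W h6 hX hW
  obtain ⟨l, c, hX⟩ := hX
  obtain ⟨e, he, hne, hmem⟩ := crossFilter (ι := Fin 6) (by simp) W hX h6 hW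
  exact ⟨l, c, e, he, hne, hmem⟩

end Summit.ValiantsHypothesis.ValiantsHypothesis.Theorems.SymPencilPerFourCrossFilter

end
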